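import Mathlib.RepresentationTheory.Maschke
import Mathlib.Topology.Instances.ZMod
import Literature.NumberTheory.EllipticCurves.NewformGaloisRep
import Literature.NumberTheory.EllipticCurves.DeligneSerreRankin
import Literature.NumberTheory.GaloisRepresentations.DeligneSerreGL2Subgroups
import Literature.NumberTheory.GaloisRepresentations.IntegralGaloisActionProofs
import Literature.NumberTheory.LFunctions.ChebotarevDensity
import Literature.NumberTheory.LFunctions.DirichletDensityLemmas
import HarnessLib

/-!
# Deligne–Serre 1974, §8.3–8.4: the images of the mod-`ℓ` representations are bounded

This file PROVES Lemme 8.4 of Deligne–Serre, *Formes modulaires de poids 1* (1974) from its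
printed inputs, each a named fact of the tree:

* `Literature.NumberTheory.EllipticCurves.ModularForms.DeligneSerre1974.prop55` (op. cit. Prop. 5.5, Rankin): for a weight-one
  eigenform and `η > 0` there are a set of primes `X_η` of upper density `≤ η` and a finite set
  `Y_η` with `a_p ∈ Y_η` for `p ∉ X_η`, `p ∤ N`;
* `Literature.NumberTheory.LFunctions.Chebotarev.dirichletDensity_eq` (Chebotarev's density theorem, Neukirch VII (13.4));
* `Literature.NumberTheory.GaloisRepresentations.DeligneSerre1974.prop72` (op. cit. Prop. 7.2): semisimple subgroups of `GL₂(𝔽_ℓ)` with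
  property `C(η, M)`, `η < 1/2`, have order `≤ A(η, M)`.

Main result: `exists_card_range_le` — for a newform `f ∈ S_1(Γ₁(N))` there is a constant `A`
such that for every prime `ℓ`, every `ι : 𝓞_f → 𝔽_ℓ` and every semisimple representation
`ρ : Gal(ℚ̄/ℚ) → GL₂(𝔽_ℓ)` attached to `f` away from `N ℓ` via `ι`
(`IsGaloisRepOfNewform1Int`), the image `G_ℓ = ρ(Gal(ℚ̄/ℚ))` has order `≤ A` (Lemme 8.4).

## The argument (op. cit. 8.3–8.4)

Apply Prop. 5.5 with `η = 1/4`. Let `H_ℓ ⊆ G_ℓ` be the set of images `ρ(F_𝔓)` of the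
arithmetic Frobenii at the primes `𝔓 ∣ p`, `p ∉ X_η`, `p ∤ N ℓ` (`frobImages`). The
characteristic polynomial of such a `ρ(F_𝔓)` is `X² − ι(a_p) X + ι(ε(p))`, and `(a_p, ε(p))`
ranges over the finite set `Y_η × ε(ℤ/Nℤ)`, so the polynomials `det(1 − hT)`, `h ∈ H_ℓ`, form a
set with at most `M = #Y_η · N` elements. The complement `G_ℓ ∖ H_ℓ` is stable under
conjugation (`H_ℓ` is, Frobenii being conjugated to Frobenii), and by Chebotarev the set of
primes whose Frobenius class meets it has density `#(G_ℓ ∖ H_ℓ)/#G_ℓ`; these primes lie in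
`X_η ∪ {p ∣ N ℓ}`, so this density is `≤ dens.sup X_η ≤ η` (Lemme 8.3). Hence `G_ℓ` has
property `C(η, M)`; it is semisimple because `ρ` is (the lattice of invariant subspaces of `ρ`
and of its image coincide), and Prop. 7.2 bounds `#G_ℓ` independently of `ℓ`.

## References

* P. Deligne, J.-P. Serre, *Formes modulaires de poids 1*, Ann. Sci. ÉNS (4) 7 (1974), §8.3,
  Lemme 8.3, Lemme 8.4 (p. 525).
-/

noncomputable section

open scoped MatrixGroups NumberField Pointwise
open CongruenceSubgroup Polynomial IsDedekindDomain Rat.HeightOneSpectrum Matrix Filter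

namespace Literature.NumberTheory.EllipticCurves.ModularForms.DeligneSerre1974

/-! ### Semisimplicity: a representation and its image have the same invariant subspaces -/

section Semisimple

variable {k : Type*} [Field k] {V : Type*} [AddCommGroup V] [Module k V]

/-- Two representations on the same space with the same operators are semisimple together
(their lattices of subrepresentations are isomorphic). [folklore] -/
theorem isSemisimpleRepresentation_iff_of_forall_exists {G H : Type*} [Monoid G] [Monoid H]
    (ρ : Representation k G V) (σ : Representation k H V)
    (h₁ : ∀ g : G, ∃ h : H, ρ g = σ h) (h₂ : ∀ h : H, ∃ g : G, σ h = ρ g) :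
    ρ.IsSemisimpleRepresentation ↔ σ.IsSemisimpleRepresentation := by
  let e : Subrepresentation ρ ≃o Subrepresentation σ :=
    { toFun := fun W ↦ ⟨W.toSubmodule, fun h v hv ↦ by
        obtain ⟨g, hg⟩ := h₂ h
        rw [hg]
        exact W.apply_mem_toSubmodule g hv⟩
      invFun := fun W ↦ ⟨W.toSubmodule, fun g v hv ↦ by
        obtain ⟨h, hh⟩ := h₁ g
        rw [hh]
        exact W.apply_mem_toSubmodule h hv⟩
      left_inv := fun W ↦ by ext; rfl
      right_inv := fun W ↦ by ext; rfl
      map_rel_iff' := Iff.rfl }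
  exact e.complementedLattice_iff

variable {G : Type*} [Group G] [TopologicalSpace G] {A : Type*} [Field A] [TopologicalSpace A]
  [IsTopologicalRing A] {n : ℕ}

/-- A framed representation is semisimple iff the identical representation of its image
subgroup `ρ(G) ⊆ GL_n(A)` is. [folklore] -/
theorem isSemisimple_toContinuousRep_iff_range (ρ : GaloisRepresentations.FramedRep G A n) :
    ρ.toContinuousRep.IsSemisimple ↔
      Representation.IsSemisimpleRepresentation
        ((GaloisRepresentations.glStdRepresentation (Fin n) A).comp (ρ : G →* GL (Fin n) A).range.subtype) := by
  refine isSemisimpleRepresentation_iff_of_forall_exists _ _ (fun g ↦ ?_) (fun h ↦ ?_)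
  · exact ⟨⟨ρ g, g, rfl⟩, rfl⟩
  · obtain ⟨g, hg⟩ := h.2
    exact ⟨g, by rw [MonoidHom.comp_apply, Subgroup.subtype_apply, ← hg]; rfl⟩

/-- **Maschke (Rem. 3.4 of Deligne–Serre 1974).** A framed representation over a field of
characteristic zero with finite image is semisimple. [folklore] -/
theorem isSemisimple_of_finite_range [CharZero A] (ρ : GaloisRepresentations.FramedRep G A n)
    (hfin : (Set.range ρ).Finite) : ρ.toContinuousRep.IsSemisimple := by
  rw [isSemisimple_toContinuousRep_iff_range]
  haveI : Finite (ρ : G →* GL (Fin n) A).range :=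
    Set.Finite.to_subtype (s := ((ρ : G →* GL (Fin n) A).range : Set (GL (Fin n) A)))
      (by rw [MonoidHom.coe_range]; exact hfin)
  haveI : NeZero (Nat.card (ρ : G →* GL (Fin n) A).range : A) :=
    ⟨Nat.cast_ne_zero.mpr Nat.card_pos.ne'⟩
  infer_instance

end Semisimple

/-! ### Frobenius images (op. cit. 8.3) -/

section FrobImages

variable {ℓ : ℕ}

/-- The set `H ⊆ GL₂(𝔽_ℓ)` of images `ρ(F_𝔓)` of the arithmetic Frobenii `F_𝔓` at the primes
`𝔓 ∣ p` of `\bar ℤ`, for the rational primes `p ∈ S` (Deligne–Serre 1974, 8.3: "`H_{ℓ,η}` la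
partie de `G_ℓ` formée des éléments de Frobenius `F_{p,ρ_ℓ}` avec `p ∉ X_η`, `p ∤ N ℓ`").
[cite: DeligneSerreASENS1974, §8.3] -/
def frobImages (ρ : GaloisRepresentations.FramedGaloisRep ℚ (ZMod ℓ) 2) (S : Set ℕ) : Set (GL (Fin 2) (ZMod ℓ)) :=
  {g | ∃ v : HeightOneSpectrum (𝓞 ℚ), ((primesEquiv v : Nat.Primes) : ℕ) ∈ S ∧
    ∃ 𝔓 ∈ v.primesAbove, ∃ σ : Field.absoluteGaloisGroup ℚ, IsArithFrobAt (𝓞 ℚ) σ 𝔓 ∧ ρ σ = g}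

/-- Frobenius images lie in the image. [folklore] -/
lemma frobImages_subset_range (ρ : GaloisRepresentations.FramedGaloisRep ℚ (ZMod ℓ) 2) (S : Set ℕ) :
    frobImages ρ S ⊆ (ρ : Field.absoluteGaloisGroup ℚ →* GL (Fin 2) (ZMod ℓ)).range := by
  rintro g ⟨v, -, 𝔓, -, σ, -, rfl⟩
  exact ⟨σ, rfl⟩

/-- A conjugate of a prime above `v` is a prime above `v`. [folklore] -/
lemma smul_mem_primesAbove {v : HeightOneSpectrum (𝓞 ℚ)} {𝔓 : Ideal (GaloisRepresentations.absIntegers (𝓞 ℚ) ℚ)}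
    (h𝔓 : 𝔓 ∈ v.primesAbove) (τ : Field.absoluteGaloisGroup ℚ) : τ • 𝔓 ∈ v.primesAbove := by
  rw [HeightOneSpectrum.mem_primesAbove_iff] at h𝔓 ⊢
  obtain ⟨h1, h2⟩ := h𝔓
  exact ⟨Ideal.IsPrime.smul τ, Ideal.LiesOver.smul τ⟩

/-- The set of Frobenius images is stable under conjugation by the image (a conjugate of a
Frobenius is a Frobenius at the conjugate prime, Mathlib `IsArithFrobAt.conj`). [folklore] -/
lemma conj_mem_frobImages {ρ : GaloisRepresentations.FramedGaloisRep ℚ (ZMod ℓ) 2} {S : Set ℕ}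
    {g : GL (Fin 2) (ZMod ℓ)} (hg : g ∈ frobImages ρ S) (τ : Field.absoluteGaloisGroup ℚ) :
    ρ τ * g * (ρ τ)⁻¹ ∈ frobImages ρ S := by
  obtain ⟨v, hv, 𝔓, h𝔓, σ, hσ, rfl⟩ := hg
  exact ⟨v, hv, τ • 𝔓, smul_mem_primesAbove h𝔓 τ, τ * σ * τ⁻¹, hσ.conj τ,
    by rw [map_mul, map_mul, map_inv]⟩

/-- The characteristic polynomials `det(1 − hT)` of the Frobenius images are the reversed
Frobenius characteristic polynomials. [folklore] -/
lemma charpolyRev_image_frobImages_subset {ρ : GaloisRepresentations.FramedGaloisRep ℚ (ZMod ℓ) 2} {S : Set ℕ}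
    (Φ : ℕ → Polynomial (ZMod ℓ))
    (hΦ : ∀ v : HeightOneSpectrum (𝓞 ℚ), ((primesEquiv v : Nat.Primes) : ℕ) ∈ S →
      ρ.HasFrobCharpolyAt v (Φ (primesEquiv v : Nat.Primes)))
    (Ys : Set (Polynomial (ZMod ℓ))) (hYs : ∀ p ∈ S, Φ p ∈ Ys) :
    (fun h : GL (Fin 2) (ZMod ℓ) ↦ charpolyRev (h : Matrix (Fin 2) (Fin 2) (ZMod ℓ))) ''
        frobImages ρ S ⊆ (fun P : Polynomial (ZMod ℓ) ↦ P.reverse) '' Ys := by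
  rintro _ ⟨g, ⟨v, hv, 𝔓, h𝔓, σ, hσ, rfl⟩, rfl⟩
  refine ⟨Φ _, hYs _ hv, ?_⟩
  have h := hΦ v hv 𝔓 h𝔓 σ hσ
  simp only [GaloisRepresentations.FramedRep.charpoly] at h
  simp only [← Matrix.reverse_charpoly, h]

end FrobImages

/-! ### Lemme 8.3: property `C(η, M)` of the image -/

section PropertyC

variable {ℓ : ℕ} [Fact ℓ.Prime]

/-- If `f` factors through `g` on `s`, then `f '' s` is an image of `g '' s`. [folklore] -/
lemma exists_image_subset_of_factors {α β γ : Type*} [Inhabited α] {s : Set α} (f : α → β)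
    (g : α → γ) (hfg : ∀ x ∈ s, ∀ y ∈ s, g x = g y → f x = f y) :
    ∃ F : γ → β, f '' s ⊆ F '' (g '' s) := by
  classical
  refine ⟨fun c ↦ f (if h : ∃ x ∈ s, g x = c then h.choose else default), ?_⟩
  rintro _ ⟨x, hx, rfl⟩
  refine ⟨g x, ⟨x, hx, rfl⟩, ?_⟩
  have h : ∃ y ∈ s, g y = g x := ⟨x, hx, rfl⟩
  simp only [dif_pos h]
  exact hfg _ h.choose_spec.1 _ hx h.choose_spec.2

/-- **Deligne–Serre 1974, Lemme 8.3 and the verification of `C(η, M)` in 8.4.** Let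
`ρ : Gal(ℚ̄/ℚ) → GL₂(𝔽_ℓ)` be a continuous representation whose Frobenius characteristic
polynomials at the primes `p ∉ X ∪ T` (`T` finite; in the source `T = {p ∣ N ℓ}`, where `ρ` is
moreover unramified, which is not needed) lie in a set of at most `M` polynomials, where
`dens.sup X ≤ η`. Then (Chebotarev) the
image `G = ρ(Gal(ℚ̄/ℚ))` has property `C(η, M)`. [cite: DeligneSerreASENS1974, Lemme 8.3] -/
theorem hasPropertyC_range (hCheb : LFunctions.Chebotarev.dirichletDensity_eq.{0})
    (ρ : GaloisRepresentations.FramedGaloisRep ℚ (ZMod ℓ) 2) {X T : Set ℕ} (hT : T.Finite) {η : ℝ}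
    (hX : upperDensity X ≤ η) (Φ : ℕ → Polynomial (ZMod ℓ))
    (hΦ : ∀ v : HeightOneSpectrum (𝓞 ℚ), ((primesEquiv v : Nat.Primes) : ℕ) ∉ T →
      ρ.HasFrobCharpolyAt v (Φ (primesEquiv v : Nat.Primes)))
    {M : ℕ} (Ys : Set (Polynomial (ZMod ℓ))) (hYfin : Ys.Finite) (hYM : Ys.ncard ≤ M)
    (hYs : ∀ p : ℕ, p.Prime → p ∉ X → p ∉ T → Φ p ∈ Ys) :
    Literature.NumberTheory.GaloisRepresentations.DeligneSerre1974.HasPropertyC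
      (ρ : Field.absoluteGaloisGroup ℚ →* GL (Fin 2) (ZMod ℓ)).range η M := by
  classical
  set Γ := Field.absoluteGaloisGroup ℚ
  set G : Subgroup (GL (Fin 2) (ZMod ℓ)) := (ρ : Γ →* GL (Fin 2) (ZMod ℓ)).range with hGdef
  -- the good primes and the Frobenius images there
  set S : Set ℕ := {p | p.Prime ∧ p ∉ X ∧ p ∉ T} with hSdef
  set Hs : Set (GL (Fin 2) (ZMod ℓ)) := frobImages ρ S with hHsdef
  have hHsG : Hs ⊆ G := frobImages_subset_range ρ S
  have hHsfin : Hs.Finite := Set.toFinite Hs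
  refine ⟨hHsfin.toFinset, by rwa [Set.Finite.coe_toFinset], ?_, ?_⟩
  swap
  · -- at most `M` characteristic polynomials
    rw [Set.Finite.coe_toFinset]
    have hsub := charpolyRev_image_frobImages_subset (ρ := ρ) (S := S) Φ
      (fun v hv ↦ hΦ v hv.2.2) Ys (fun p hp ↦ hYs p hp.1 hp.2.1 hp.2.2)
    calc ((fun h : GL (Fin 2) (ZMod ℓ) ↦ charpolyRev (h : Matrix (Fin 2) (Fin 2) (ZMod ℓ))) ''
            frobImages ρ S).ncard
        ≤ ((fun P : Polynomial (ZMod ℓ) ↦ P.reverse) '' Ys).ncard :=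
          Set.ncard_le_ncard hsub (hYfin.image _)
      _ ≤ Ys.ncard := Set.ncard_image_le hYfin
      _ ≤ M := hYM
  · -- Chebotarev: the complement of `Hs` in `G` is hit by a set of primes of density
    -- `#(G ∖ Hs) / #G`, contained in `X ∪ T`
    set φ : Γ →* G := (ρ : Γ →* GL (Fin 2) (ZMod ℓ)).rangeRestrict with hφdef
    have hφsurj : Function.Surjective φ := MonoidHom.rangeRestrict_surjective _
    have hφker : IsOpen ((φ.ker : Subgroup Γ) : Set Γ) := by
      have : ((φ.ker : Subgroup Γ) : Set Γ) = ρ ⁻¹' {1} := by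
        ext σ
        simp only [SetLike.mem_coe, MonoidHom.mem_ker, Set.mem_preimage, Set.mem_singleton_iff,
          hφdef]
        rw [← Subtype.coe_inj, MonoidHom.coe_rangeRestrict, OneMemClass.coe_one]
        rfl
      rw [this]
      exact (isOpen_discrete _).preimage ρ.continuous
    set C : Set G := {g | (g : GL (Fin 2) (ZMod ℓ)) ∉ Hs} with hCdef
    have hCconj : ∀ g h : G, h ∈ C → g * h * g⁻¹ ∈ C := by
      intro g h hh hgh
      apply hh
      obtain ⟨τ, hτ⟩ := MonoidHom.mem_range.mp g.2
      have key := conj_mem_frobImages hgh τ⁻¹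
      have hτ' : ρ τ⁻¹ = (g : GL (Fin 2) (ZMod ℓ))⁻¹ := by rw [map_inv]; exact congrArg _ hτ
      rw [hτ'] at key
      simpa [mul_assoc] using key
    have hdens := hCheb φ hφker hφsurj C hCconj
    -- the primes produced by Chebotarev lie in `X ∪ T`
    have hsubXT : ∀ p : ℕ, p.Prime → p ∈ LFunctions.Chebotarev.frobPrimes φ C → p ∈ X ∨ p ∈ T := by
      intro p hp hpC
      by_contra! hnot
      obtain ⟨v, rfl, -, hfrob⟩ := hpC
      obtain ⟨𝔓, h𝔓⟩ := HeightOneSpectrum.primesAbove_nonempty v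
      obtain ⟨σ, hσ⟩ := HeightOneSpectrum.exists_isArithFrobAt_of_mem_primesAbove_holds h𝔓
      have hC := hfrob 𝔓 h𝔓 σ hσ
      exact hC ⟨v, ⟨hp, hnot.1, hnot.2⟩, 𝔓, h𝔓, σ, hσ, rfl⟩
    have hle : (Nat.card C : ℝ) / Nat.card G ≤ η :=
      (LFunctions.PrimeSum.le_upperDensity_of_tendsto hT hsubXT hdens).trans hX
    -- bookkeeping: `#G = #Hs + #C`
    have hGpos : (0 : ℝ) < Nat.card G := Nat.cast_pos.mpr Nat.card_pos
    have hcard : (Nat.card G : ℝ) = hHsfin.toFinset.card + Nat.card C := by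
      have h1 : ({g : G | (g : GL (Fin 2) (ZMod ℓ)) ∈ Hs} : Set G).ncard = Hs.ncard := by
        change (Subtype.val ⁻¹' Hs).ncard = Hs.ncard
        refine Set.ncard_preimage_of_injective_subset_range Subtype.val_injective ?_
        rwa [Subtype.range_val]
      have h2 := Set.ncard_add_ncard_compl ({g : G | (g : GL (Fin 2) (ZMod ℓ)) ∈ Hs} : Set G)
      have h3 : ({g : G | (g : GL (Fin 2) (ZMod ℓ)) ∈ Hs} : Set G)ᶜ = C := by
        ext g; simp [hCdef]
      rw [h3, h1] at h2
      have h4 : hHsfin.toFinset.card = Hs.ncard := by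
        rw [← Set.ncard_coe_finset, Set.Finite.coe_toFinset]
      rw [h4, Nat.card_coe_set_eq]
      exact_mod_cast h2.symm
    have hCle : (Nat.card C : ℝ) ≤ η * Nat.card G := by
      rwa [div_le_iff₀ hGpos] at hle
    rw [hcard] at hCle ⊢
    nlinarith [hCle, hcard]

end PropertyC

/-! ### Lemme 8.4: the bound -/

section Bound

variable {N : ℕ} [NeZero N]

omit [NeZero N] in
/-- A normalised cusp form is non-zero. [folklore] -/
lemma ne_zero_of_isNormalized {k : ℤ} {f : CuspForm (Gamma1 N) k} (hf : IsNormalized f) :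
    f ≠ 0 := by
  rintro rfl
  simp [IsNormalized, CuspForm.coe_zero, UpperHalfPlane.qExpansion_zero] at hf

/-- The Hecke polynomial of `f` at `q` only depends on `(a_q, ε(q) q^{k-1})`. [folklore] -/
lemma heckePolynomial_eq_of_eq {k : ℤ} (f : CuspForm (Gamma1 N) k) {p q : ℕ}
    (ha : (UpperHalfPlane.qExpansion 1 ⇑f).coeff p = (UpperHalfPlane.qExpansion 1 ⇑f).coeff q)
    (he : (nebentypus f (p : ZMod N) : ℂ) * (p : ℂ) ^ (k - 1) =
      (nebentypus f (q : ZMod N) : ℂ) * (q : ℂ) ^ (k - 1)) :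
    heckePolynomial f p = heckePolynomial f q := by
  unfold heckePolynomial
  have h1 : (⟨_, cuspCoeff_mem_coeffCharField f p⟩ : coeffCharField f) =
      ⟨_, cuspCoeff_mem_coeffCharField f q⟩ := Subtype.ext ha
  have h2 : (⟨_, nebentypus_mul_zpow_mem_coeffCharField f p⟩ : coeffCharField f) =
      ⟨_, nebentypus_mul_zpow_mem_coeffCharField f q⟩ := Subtype.ext he
  rw [h1, h2]

/-- **Deligne–Serre 1974, Lemme 8.4.** Let `f ∈ S_1(Γ₁(N))` be a newform. There is a constant
`A` such that for every prime `ℓ`, every `ι : 𝓞_f → 𝔽_ℓ` and every semisimple continuous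
representation `ρ : Gal(ℚ̄/ℚ) → GL₂(𝔽_ℓ)` attached to `f` away from `N ℓ` via `ι` (unramified,
with `charpoly ρ(F_p) = X² − ι(a_p) X + ι(ε(p))`, `p ∤ N ℓ`), the image `G_ℓ` of `ρ` has
order `#G_ℓ ≤ A`. Inputs: Prop. 5.5, Chebotarev, Prop. 7.2 (with `η = 1/4`,
`M = #Y_{1/4} · N`), and the newform facts `T_p f = a_p f`, `f ∈ S_1(N, ε)`.
[cite: DeligneSerreASENS1974, Lemme 8.4] -/
theorem exists_card_range_le (h55 : prop55) (h72 : Literature.NumberTheory.GaloisRepresentations.DeligneSerre1974.prop72)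
    (hCheb : LFunctions.Chebotarev.dirichletDensity_eq.{0})
    (hneb : IsNewform1.mem_nebentypusSubspace_nebentypus (N := N) (k := 1))
    (heig : IsNewform1.heckeEigenvalue_eq_coeff (N := N) (k := 1))
    {f : CuspForm (Gamma1 N) 1} (hf : IsNewform1 f) :
    ∃ A : ℕ, ∀ (ℓ : ℕ) [Fact ℓ.Prime] (ι : coeffCharIntegers f →+* ZMod ℓ)
      (ρ : GaloisRepresentations.FramedGaloisRep ℚ (ZMod ℓ) 2),
      IsGaloisRepOfNewform1Int f ι {p | p ∣ N * ℓ} ρ → ρ.toGaloisRep.IsSemisimple →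
      Nat.card (ρ : Field.absoluteGaloisGroup ℚ →* GL (Fin 2) (ZMod ℓ)).range ≤ A := by
  classical
  -- Prop. 5.5 with `η = 1/4`
  have hf0 : f ≠ 0 := ne_zero_of_isNormalized hf.2.2.2
  have heigen : ∀ p : ℕ, (hp : p.Prime) → ¬ p ∣ N →
      ∃ a : ℂ, (haveI : NeZero p := ⟨hp.ne_zero⟩; heckeT (Gamma1 N) 1 p f) = a • f :=
    fun p hp _ ↦ hf.2.1 p hp
  obtain ⟨X, Y, hXdens, hY⟩ := h55 (nebentypus f) f (hneb hf) hf0 heigen (1 / 4) (by norm_num)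
  -- Prop. 7.2 with `η = 1/4`, `M = #Y · N`
  obtain ⟨A, hA⟩ := h72 (1 / 4) (Y.card * N) (by norm_num) (by norm_num)
  refine ⟨A, fun ℓ _ ι ρ hρ hss ↦ hA ℓ _ ?_ ?_⟩
  · -- semisimplicity of the image
    exact (isSemisimple_toContinuousRep_iff_range ρ).mp hss
  · -- property `C(1/4, #Y · N)`
    set T : Set ℕ := {p | p ∣ N * ℓ} with hTdef
    have hT : T.Finite := by
      refine Set.Finite.subset (Set.finite_Iic (N * ℓ)) fun p hp ↦ ?_
      exact Nat.le_of_dvd (Nat.pos_of_ne_zero (mul_ne_zero (NeZero.ne N)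
        (Fact.out : ℓ.Prime).ne_zero)) hp
    -- the Frobenius characteristic polynomials, as a function of `p`
    let Φ : ℕ → Polynomial (ZMod ℓ) := fun p ↦
      if h : ∃ P : Polynomial (coeffCharIntegers f),
          P.map (algebraMap (coeffCharIntegers f) (coeffCharField f)) = heckePolynomial f p
        then h.choose.map ι else 0
    have hinj : Function.Injective
        (Polynomial.map (algebraMap (coeffCharIntegers f) (coeffCharField f))) :=
      Polynomial.map_injective _ (fun _ _ h ↦ Subtype.ext h)
    have hΦ : ∀ v : HeightOneSpectrum (𝓞 ℚ), ((primesEquiv v : Nat.Primes) : ℕ) ∉ T →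
        ρ.HasFrobCharpolyAt v (Φ (primesEquiv v : Nat.Primes)) := by
      intro v hv 𝔓 h𝔓 σ hσ
      obtain ⟨-, P, hP, hch⟩ := hρ v hv
      have hex : ∃ P : Polynomial (coeffCharIntegers f),
          P.map (algebraMap (coeffCharIntegers f) (coeffCharField f)) =
            heckePolynomial f (primesEquiv v : Nat.Primes) := ⟨P, hP⟩
      have hPeq : hex.choose = P := hinj (hex.choose_spec.trans hP.symm)
      simp only [Φ, dif_pos hex, hPeq]
      exact hch 𝔓 h𝔓 σ hσ
    -- `Φ p` only depends on `(a_p, ε(p))`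
    let key : ℕ → ℂ × ℂ := fun p ↦
      ((UpperHalfPlane.qExpansion 1 ⇑f).coeff p, (nebentypus f (p : ZMod N) : ℂ))
    set S : Set ℕ := {p | p.Prime ∧ p ∉ X ∧ p ∉ T} with hSdef
    have hfac : ∀ p ∈ S, ∀ q ∈ S, key p = key q → Φ p = Φ q := by
      intro p _ q _ hpq
      simp only [key, Prod.mk.injEq] at hpq
      have hH : heckePolynomial f p = heckePolynomial f q :=
        heckePolynomial_eq_of_eq f hpq.1 (by simp [hpq.2])
      simp only [Φ, hH]
    have hkey : key '' S ⊆ (↑Y : Set ℂ) ×ˢ Set.range (fun x : ZMod N ↦ (nebentypus f x : ℂ)) := by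
      rintro _ ⟨p, hp, rfl⟩
      refine ⟨?_, ⟨(p : ZMod N), rfl⟩⟩
      have hpN : ¬ p ∣ N := fun h ↦ hp.2.2 (Dvd.dvd.mul_right h ℓ)
      have := hY p hp.1 hpN hp.2.1
      rwa [heig hf hp.1] at this
    have hrange : (Set.range (fun x : ZMod N ↦ (nebentypus f x : ℂ))).Finite :=
      Set.finite_range _
    have hprodfin : ((↑Y : Set ℂ) ×ˢ Set.range (fun x : ZMod N ↦ (nebentypus f x : ℂ))).Finite :=
      Set.Finite.prod Y.finite_toSet hrange
    have hkeyfin : (key '' S).Finite := hprodfin.subset hkey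
    obtain ⟨F, hF⟩ := exists_image_subset_of_factors Φ key hfac
    have hΦfin : (Φ '' S).Finite := (hkeyfin.image F).subset hF
    refine hasPropertyC_range hCheb ρ hT hXdens Φ hΦ (Φ '' S)
      hΦfin ?_ (fun p hp hpX hpT ↦ ⟨p, ⟨hp, hpX, hpT⟩, rfl⟩)
    calc (Φ '' S).ncard ≤ (F '' (key '' S)).ncard := Set.ncard_le_ncard hF (hkeyfin.image F)
      _ ≤ (key '' S).ncard := Set.ncard_image_le hkeyfin
      _ ≤ ((↑Y : Set ℂ) ×ˢ Set.range (fun x : ZMod N ↦ (nebentypus f x : ℂ))).ncard :=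
        Set.ncard_le_ncard hkey hprodfin
      _ = Y.card * (Set.range (fun x : ZMod N ↦ (nebentypus f x : ℂ))).ncard := by
        rw [Set.ncard_prod, Set.ncard_coe_finset]
      _ ≤ Y.card * N := by
        gcongr
        calc (Set.range (fun x : ZMod N ↦ (nebentypus f x : ℂ))).ncard
            ≤ (Set.univ : Set (ZMod N)).ncard := by
              rw [← Set.image_univ]
              exact Set.ncard_image_le Set.finite_univ
          _ = N := by rw [Set.ncard_univ, Nat.card_zmod]

end Bound

end Literature.NumberTheory.EllipticCurves.ModularForms.DeligneSerre1974
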